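import Summits.Ventures.YMGap.RobustBall.FluxDefectOfRange
import HarnessLib

/-!
# RobustBall/FluxDefectRows — the counting step (P4): defect rows of a range-`r` member are `≤ K(d, r) · ε₀`; hence THE
# TIER-1 RANGE-`r` BALL (oscillation load `ε₀`, NO Lipschitz load, any `N`-ality) AROUND EVERY CENTRE-BLIND ACTION IS IN THE
# WINDOWED CENTRE TUBE

HONEST FRAMING: venture file of the cell `pub-ymgap` (track Y2 ROBUST-BALL, seat ds-4 g8); finite counting on the torus.  WHAT THIS IS:
for `W ∈ ClusterDomainFR ε₀ ε₁ r` (finite range `r`, per-link oscillation load `≤ ε₀`; the Lipschitz radius `ε₁` is IDLE) on a torus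
with `2r + 2 < L`: the defect rows of `FluxDefectOfRange` obey
`∑_{X : y ∈ iLinks i (boxSupp r X)} oscSumR w r X (|iLinks i (boxSupp r X)| − 1) ≤ K(d, r) ε₀`, `K(d, r) = ((2r+2)^d − 1)·d·(4r+3)^d`
(`rows_le_of_loadWitness`: a box has `≤ (2r+2)^d` sites; a polymer whose box reads `y` lies within cyclic distance `2r+1` of `y`, and there
are `≤ d(4r+3)^d` links based there, each carrying oscillation load `≤ ε₀`).  Hence ★ `isFluxLocalW_of_clusterDomainFR` and ★★
`areaLaw_clusterDomainFR_add_twistBlind`: for EVERY twist-blind `W_b` (any size, any range) and EVERY `W ∈ ClusterDomainFR ε₀ ε₁ r`,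
`|⟨W_{R×T}⟩_{β, W_b + W, L}| ≤ (4 c^{⌈T/(2r+1)⌉})^{#{ρ<R : (2r+2)∣ρ}}` at `c = 2(d−1)N|β| + K(d, r) ε₀ ≤ 1` — the range-`r` tier-1 ball around
the whole centre-blind affine subspace.  HONEST LABEL: strong-coupling lattice inequality (centre-projected `ℤ_N` flux picture); the
constant `K(d, r)` is a crude counting constant (SU(2), `d = 4`, `r = 1`: `K = 255·4·7⁴ = 2 449 020`), so the cell is qualitative — the point is the
OPENNESS of the class in the tier-1 topology, uniformly in the blind background; `β`-window smaller than tier 1's; requires `L > 2r + 2`;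
nothing continuum / Clay; T15's unwindowed loop terms remain outside (they have unbounded range).
-/

noncomputable section

open Finset Function
open Literature.MathematicalPhysics.QuantumLattice (fundamentalRep)
open Literature.MathematicalPhysics.QuantumFieldTheory

namespace Summit.Ventures.YMGap.RobustBall

open ZN ZNFluxW

variable {d L N : ℕ} [NeZero L] [NeZero N]

/-! ### Counting sites in a box and near a site -/

omit [NeZero N] in
open Classical in
/-- **A box of side `n` has at most `n^d` sites** (injection by offsets into `Fin d → range n`). [folklore] -/
theorem card_filter_box_le (c : Site d L) (n : ℕ) :
    ((Finset.univ : Finset (Site d L)).filter fun y : Site d L => Box c (fun _ => n) y).card ≤ n ^ d := by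
  have h := Finset.card_le_card_of_injOn (s := (Finset.univ : Finset (Site d L)).filter fun y : Site d L => Box c (fun _ => n) y)
    (t := Fintype.piFinset fun _ : Fin d => Finset.range n) (fun y v => (y v - c v).val) (fun y hy => by
      rw [Finset.mem_coe, Finset.mem_filter] at hy
      exact Finset.mem_coe.2 (Fintype.mem_piFinset.2 fun v => Finset.mem_range.2 (hy.2 v)))
    (fun y _ y' _ hyy' => by
      funext v
      have hv := congrFun hyy' v
      exact sub_left_injective (ZMod.val_injective L hv))
  simpa [Fintype.card_piFinset, Finset.card_range] using h

omit [NeZero N] in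
open Classical in
/-- The `i`-links of a box support: at most `(2r+2)^d`. [folklore] -/
theorem card_iLinks_boxSupp_le (r : ℕ) (X : Finset (Site d L)) (i : Fin d) :
    (iLinks i (boxSupp r X)).card ≤ (2 * r + 2) ^ d := by
  have hsub : iLinks i (boxSupp r X) ⊆
      (Finset.univ : Finset (Site d L)).filter fun y : Site d L => Box (boxCorner r X) (fun _ => 2 * r + 2) y :=
    fun y hy => Finset.mem_filter.2 ⟨Finset.mem_univ _, polyBox_of_mem_iLinks i hy⟩
  exact (Finset.card_le_card hsub).trans (card_filter_box_le (boxCorner r X) (2 * r + 2))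

/-- `z` is within cyclic distance `2r + 1` of `y` in every coordinate. [folklore] -/
def Near (r : ℕ) (y z : Site d L) : Prop := ∀ v, (z v - y v).valMinAbs.natAbs ≤ 2 * r + 1

omit [NeZero N] in
open Classical in
/-- **At most `(4r+3)^d` sites are near a given site** (injection by centred representatives). [folklore] -/
theorem card_filter_near_le (r : ℕ) (y : Site d L) :
    ((Finset.univ : Finset (Site d L)).filter fun z : Site d L => Near r y z).card ≤ (4 * r + 3) ^ d := by
  have h := Finset.card_le_card_of_injOn (s := (Finset.univ : Finset (Site d L)).filter fun z : Site d L => Near r y z)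
    (t := Fintype.piFinset fun _ : Fin d => Finset.range (4 * r + 3))
    (fun z v => ((z v - y v).valMinAbs + (2 * r + 1 : ℕ)).toNat) (fun z hz => by
      rw [Finset.mem_coe, Finset.mem_filter] at hz
      refine Finset.mem_coe.2 (Fintype.mem_piFinset.2 fun v => Finset.mem_range.2 ?_)
      have h1 := hz.2 v
      have h2 : ((z v - y v).valMinAbs + (2 * r + 1 : ℕ)).toNat < 4 * r + 3 := by
        omega
      exact h2)
    (fun z hz z' hz' hzz' => by
      rw [Finset.mem_coe, Finset.mem_filter] at hz hz'
      funext v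
      have hv := congrFun hzz' v
      simp only at hv
      have h0 : 0 ≤ (z v - y v).valMinAbs + (2 * r + 1 : ℕ) := by have := hz.2 v; omega
      have h0' : 0 ≤ (z' v - y v).valMinAbs + (2 * r + 1 : ℕ) := by have := hz'.2 v; omega
      have heq : (z v - y v).valMinAbs = (z' v - y v).valMinAbs := by
        have := Int.toNat_of_nonneg h0; have := Int.toNat_of_nonneg h0'; omega
      have heq' : z v - y v = z' v - y v := by
        rw [← ZMod.coe_valMinAbs (z v - y v), ← ZMod.coe_valMinAbs (z' v - y v), heq]
      exact sub_left_injective heq')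
  simpa [Fintype.card_piFinset, Finset.card_range] using h

omit [NeZero N] in
open Classical in
/-- **At most `d (4r+3)^d` links are based near a given site.** [folklore] -/
theorem card_filter_near_edge_le (r : ℕ) (y : Site d L) :
    ((Finset.univ : Finset (Edge d L)).filter fun e : Edge d L => Near r y e.1).card ≤ d * (4 * r + 3) ^ d := by
  have hEq : ((Finset.univ : Finset (Edge d L)).filter fun e : Edge d L => Near r y e.1) =
      ((Finset.univ : Finset (Site d L)).filter fun z : Site d L => Near r y z) ×ˢ (Finset.univ : Finset (Fin d)) := by
    ext ⟨z, v⟩; simp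
  rw [hEq, Finset.card_product, Finset.card_univ, Fintype.card_fin, mul_comm]
  exact Nat.mul_le_mul_left d (card_filter_near_le r y)

omit [NeZero N] in
/-- `|t|_{ℤ/L} ≤ |t|` for an integer `t`. [folklore] -/
theorem natAbs_valMinAbs_intCast_le (t : ℤ) : ((t : ZMod L)).valMinAbs.natAbs ≤ t.natAbs :=
  ZMod.natAbs_min_of_le_div_two L _ _ (by rw [ZMod.coe_valMinAbs]) (ZMod.natAbs_valMinAbs_le _)

omit [NeZero N] in
/-- **A small polymer whose box reads `y` lies near `y`**: `polymerDiam X ≤ r`, `y` an `i`-link of `boxSupp r X`, `z ∈ X` ⇒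
`Near r y z`. [folklore] -/
theorem near_of_mem {r : ℕ} {X : Finset (Site d L)} (hX : polymerDiam X ≤ r) {i : Fin d} {y : Site d L}
    (hy : y ∈ iLinks i (boxSupp r X)) {z : Site d L} (hz : z ∈ X) : Near r y z := by
  intro v
  have hbox := polyBox_of_mem_iLinks i hy
  have hb : basePt X ∈ X := basePt_mem ⟨z, hz⟩
  have h1 : (z v - basePt X v).valMinAbs.natAbs ≤ r := (natAbs_valMinAbs_sub_le_polymerDiam hz hb v).trans hX
  -- the base point is within `r + 1` of `y`
  have ha : (y v - boxCorner r X v).val < 2 * r + 2 := hbox v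
  have h2 : (basePt X v - y v).valMinAbs.natAbs ≤ r + 1 := by
    have e : basePt X v - y v = (((r : ℤ) - ((y v - boxCorner r X v).val : ℕ) : ℤ) : ZMod L) := by
      have e1 : (((y v - boxCorner r X v).val : ℕ) : ZMod L) = y v - boxCorner r X v := ZMod.natCast_zmod_val _
      push_cast
      rw [e1]; simp [boxCorner]; ring
    rw [e]
    refine (natAbs_valMinAbs_intCast_le _).trans ?_
    omega
  have h3 := ZMod.natAbs_valMinAbs_add_le (z v - basePt X v) (basePt X v - y v)
  rw [show z v - basePt X v + (basePt X v - y v) = z v - y v by ring] at h3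
  have h4 := Int.natAbs_add_le (z v - basePt X v).valMinAbs (basePt X v - y v).valMinAbs
  omega

/-! ### The defect rows -/

omit [NeZero N] in
/-- The unweighted oscillation load at a link is the plain sum of the oscillation bounds through it. [folklore] -/
theorem oscLoad_zero_eq {W : Perturbation d L N} (w : LoadWitness W) (e : Edge d L) :
    w.oscLoad 0 e = ∑ X ∈ polymersThroughEdge e, w.osc X e := by
  simp [LoadWitness.oscLoad]

omit [NeZero N] in
/-- **DEFECT ROWS OF A RANGE-`r` MEMBER**: `∑_{X : y ∈ iLinks i (boxSupp r X)} oscSumR w r X (|iLinks| − 1) ≤ ((2r+2)^d − 1) · d (4r+3)^d · ε₀`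
when every oscillation load is `≤ ε₀`. [folklore] -/
theorem rows_le_of_loadWitness {r : ℕ} {W : Perturbation d L N} (w : LoadWitness W) {ε₀ : ℝ} (hε : ∀ e, w.oscLoad 0 e ≤ ε₀)
    (i : Fin d) (y : Site d L) :
    ∑ X ∈ (Finset.univ : Finset (Finset (Site d L))).filter (fun X => y ∈ iLinks i (boxSupp r X)),
        oscSumR w r X * (((iLinks i (boxSupp r X)).card : ℝ) - 1) ≤
      (((2 * r + 2 : ℕ) : ℝ) ^ d - 1) * ((d : ℝ) * ((4 * r + 3 : ℕ) : ℝ) ^ d) * ε₀ := by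
  classical
  set F := (Finset.univ : Finset (Finset (Site d L))).filter (fun X => y ∈ iLinks i (boxSupp r X)) with hF
  set E := (Finset.univ : Finset (Edge d L)).filter (fun e : Edge d L => Near r y e.1) with hE
  have hε0 : 0 ≤ ε₀ := le_trans (by
    rw [oscLoad_zero_eq]; exact Finset.sum_nonneg fun X _ => (w.osc_spec X).nonneg _) (hε ((Classical.arbitrary (Site d L)), i))
  -- Step 1: the cardinality factor
  have h1 : ∑ X ∈ F, oscSumR w r X * (((iLinks i (boxSupp r X)).card : ℝ) - 1) ≤
      ∑ X ∈ F, oscSumR w r X * (((2 * r + 2 : ℕ) : ℝ) ^ d - 1) := by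
    refine Finset.sum_le_sum fun X _ => mul_le_mul_of_nonneg_left ?_ (oscSumR_nonneg w r X)
    have := card_iLinks_boxSupp_le r X i
    have h' : ((iLinks i (boxSupp r X)).card : ℝ) ≤ ((2 * r + 2 : ℕ) : ℝ) ^ d := by exact_mod_cast this
    linarith
  -- Step 2: the polymer sum is controlled by the oscillation loads of the nearby links
  have h2 : ∑ X ∈ F, oscSumR w r X ≤ ∑ e ∈ E, w.oscLoad 0 e := by
    calc ∑ X ∈ F, oscSumR w r X
        ≤ ∑ X ∈ F, ∑ e ∈ E, (if e ∈ polymerEdges 1 X ∧ polymerDiam X ≤ r then w.osc X e else 0) := by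
          refine Finset.sum_le_sum fun X hX => ?_
          unfold oscSumR
          split_ifs with hXr
          · rw [oscSum]
            have hsub : polymerEdges 1 X ⊆ E := fun e he => by
              rw [hE, Finset.mem_filter]
              refine ⟨Finset.mem_univ _, near_of_mem hXr (Finset.mem_filter.1 hX).2 ?_⟩
              simpa using he
            rw [← Finset.sum_subset hsub (f := fun e => if e ∈ polymerEdges 1 X ∧ polymerDiam X ≤ r then w.osc X e else 0)
              (fun e _ he => by simp [he])]
            exact Finset.sum_le_sum fun e he => by simp [he, hXr]
          · exact Finset.sum_nonneg fun e _ => by split_ifs <;> [exact (w.osc_spec X).nonneg e; exact le_rfl]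
      _ = ∑ e ∈ E, ∑ X ∈ F, (if e ∈ polymerEdges 1 X ∧ polymerDiam X ≤ r then w.osc X e else 0) := Finset.sum_comm
      _ ≤ ∑ e ∈ E, w.oscLoad 0 e := by
          refine Finset.sum_le_sum fun e _ => ?_
          rw [oscLoad_zero_eq]
          calc ∑ X ∈ F, (if e ∈ polymerEdges 1 X ∧ polymerDiam X ≤ r then w.osc X e else 0)
              ≤ ∑ X ∈ (Finset.univ : Finset (Finset (Site d L))),
                  (if e ∈ polymerEdges 1 X ∧ polymerDiam X ≤ r then w.osc X e else 0) :=
                Finset.sum_le_sum_of_subset_of_nonneg (Finset.filter_subset _ _) fun X _ _ => by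
                  split_ifs <;> [exact (w.osc_spec X).nonneg e; exact le_rfl]
            _ ≤ ∑ X ∈ polymersThroughEdge e, w.osc X e := by
                rw [← Finset.sum_filter]
                refine Finset.sum_le_sum_of_subset_of_nonneg (fun X hX => ?_) fun X _ _ => (w.osc_spec X).nonneg e
                rw [Finset.mem_filter] at hX
                rw [polymersThroughEdge, Finset.mem_filter]
                exact ⟨mem_polymers_one X, hX.2.1⟩
  have h3 : ∑ e ∈ E, w.oscLoad 0 e ≤ ((d : ℝ) * ((4 * r + 3 : ℕ) : ℝ) ^ d) * ε₀ := by
    calc ∑ e ∈ E, w.oscLoad 0 e ≤ ∑ e ∈ E, ε₀ := Finset.sum_le_sum fun e _ => hε e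
      _ = (E.card : ℝ) * ε₀ := by rw [Finset.sum_const, nsmul_eq_mul]
      _ ≤ ((d : ℝ) * ((4 * r + 3 : ℕ) : ℝ) ^ d) * ε₀ := by
          refine mul_le_mul_of_nonneg_right ?_ hε0
          exact_mod_cast card_filter_near_edge_le r y
  have hK0 : 0 ≤ ((2 * r + 2 : ℕ) : ℝ) ^ d - 1 := by
    have : (1 : ℝ) ≤ ((2 * r + 2 : ℕ) : ℝ) ^ d := one_le_pow₀ (by exact_mod_cast (by omega : 1 ≤ 2 * r + 2))
    linarith
  calc ∑ X ∈ F, oscSumR w r X * (((iLinks i (boxSupp r X)).card : ℝ) - 1)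
      ≤ ∑ X ∈ F, oscSumR w r X * (((2 * r + 2 : ℕ) : ℝ) ^ d - 1) := h1
    _ = (((2 * r + 2 : ℕ) : ℝ) ^ d - 1) * ∑ X ∈ F, oscSumR w r X := by rw [← Finset.sum_mul, mul_comm]
    _ ≤ (((2 * r + 2 : ℕ) : ℝ) ^ d - 1) * (((d : ℝ) * ((4 * r + 3 : ℕ) : ℝ) ^ d) * ε₀) :=
        mul_le_mul_of_nonneg_left (h2.trans h3) hK0
    _ = (((2 * r + 2 : ℕ) : ℝ) ^ d - 1) * ((d : ℝ) * ((4 * r + 3 : ℕ) : ℝ) ^ d) * ε₀ := by ring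

/-! ### The tier-1 ball around every centre-blind action -/

/-- The counting constant `K(d, r) = ((2r+2)^d − 1) · d · (4r+3)^d`. [folklore] -/
def rowConst (d r : ℕ) : ℝ := (((2 * r + 2 : ℕ) : ℝ) ^ d - 1) * ((d : ℝ) * ((4 * r + 3 : ℕ) : ℝ) ^ d)

/-- **EVERY MEMBER OF THE RANGE-`r` TIER-1 BALL IS IN THE WINDOWED CENTRE TUBE** (`2r + 2 < L`):
`W ∈ ClusterDomainFR ε₀ ε₁ r → IsFluxLocalW (2r+2) (2r+1) (K(d,r)·ε₀) W` — oscillation load only, the Lipschitz radius `ε₁` is idle.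
[folklore] -/
theorem isFluxLocalW_of_clusterDomainFR {r : ℕ} (hL : 2 * r + 2 < L) {ε₀ ε₁ : ℝ} {W : Perturbation d L N}
    (hW : W ∈ ClusterDomainFR ε₀ ε₁ r) : IsFluxLocalW (2 * r + 2) (2 * r + 1) (rowConst d r * ε₀) W := by
  obtain ⟨hR, w, hw0, -⟩ := hW
  exact isFluxLocalW_of_hasRange hL hR w fun i y => (rows_le_of_loadWitness w hw0 i y).trans (le_of_eq rfl)

/-- **THE TIER-1 BALL AROUND EVERY CENTRE-BLIND ACTION — windowed centre-tube bound** (`N ≥ 2`, `2r + 2 < L`): for EVERY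
twist-blind `W_b` (any size, any range) and EVERY `W ∈ ClusterDomainFR ε₀ ε₁ r`, at `c = 2(d−1)N|β| + K(d,r)ε₀ ≤ 1`:
`|⟨W_{R×T}⟩_{β, W_b + W, L}| ≤ (4 c^{⌈T/(2r+1)⌉})^{#{ρ<R : (2r+2)∣ρ}}`. [folklore] -/
theorem areaLaw_clusterDomainFR_add_twistBlind (hN : 2 ≤ N) {r : ℕ} (hL : 2 * r + 2 < L) {β ε₀ ε₁ c : ℝ}
    {Wb W : Perturbation d L N} (hb : IsTwistBlind Wb) (hW : W ∈ ClusterDomainFR ε₀ ε₁ r)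
    (hc : 2 * ((d - 1 : ℕ) : ℝ) * |β| * N + rowConst d r * ε₀ ≤ c) (hc1 : c ≤ 1) (x : Site d L) {i j : Fin d} (hij : i ≠ j)
    {R T : ℕ} (hR : 2 * R ≤ L) (hT : 2 * T ≤ L) :
    |(Wb + W).expectation (fundamentalRep (Fin N)) β (wilsonLoop (fundamentalRep (Fin N)) x i j R T)| ≤
      (4 * c ^ ((T + (2 * r + 1) - 1) / (2 * r + 1))) ^ (selIdx (2 * r + 2) R).card :=
  abs_wilsonLoop_le_of_isFluxLocalW hN (by omega) (by omega) hc hc1 _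
    (IsFluxLocalW.twistBlind_add hb (isFluxLocalW_of_clusterDomainFR hL hW)) x hij hR hT

end Summit.Ventures.YMGap.RobustBall

end
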